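import Literature.AnabelianGeometry.AbsoluteAnabelian.AbsTopIII.FrobeniusPictureMLFTelecore
import Literature.AnabelianGeometry.AbsoluteAnabelian.DiagramCores

/-!
# [AbsTopIII] Corollary 3.6 (i) DISCHARGED over the abstract data (+ the nexus half of (v), non-vacuity of (ii)–(iv))

S. Mochizuki, *Topics in Absolute Anabelian Geometry III*, Cor. 3.6 (i) p. 79 (manuscript
`paper:url-5493eb38cbb7`; bib key `MochizukiAbsTopIII2015`): "For `n = 4, 5, 6`, `𝒟_{≤n}` admits
a natural structure of core on `𝒟_{≤n-1}`.  That is to say, loosely speaking, `ℰ`, `Anab` 'form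
cores' of the functors in `𝒟`."  Proof (p. 80): "immediate from the definitions and the fact that
the algorithms of Corollary 1.10 are 'group-theoretic'", i.e. every functor of the diagram lies
over the Galois group.

Over the ABSTRACT input `Δ : LogFrobeniusData` (seat abc-iut-L4-t2's `LogFrobeniusDiagram.lean`)
this is exactly the content of the data: `log ≅ 𝟭` (`logIsoId`), `λ^× ⋙ (𝒩 → ℰ) = λ^{×pf} ⋙ (𝒩 → ℰ)
= (𝒳 → ℰ)` (`lamTimes_NtoE`, `lamPf_NtoE`), `κ_An ⋙ (Anab → ℰ) ≅ 𝟭` (`κ_inv`).  We package these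
as structure functors over `ℰ` on the whole diagram (`overE`, "every functor of `𝒟` lies over
`ℰ`"), restrict / push them along `κ_An`, and apply the core construction of `DiagramCores.lean`
(`coreObservable`, `isCore_coreObservable`).  RESULT: the three statements `CoreStmt4`,
`CoreStmt5`, `CoreStmt6` of `FrobeniusPictureMLF.lean` (typed Cor. 3.6 (i), `n = 4, 5, 6`) are
THEOREMS for every `Δ` — in particular for the MLF-Galois instance, once supplied.  The families
constructed are the printed "natural" ones: the homotopy between two paths into `ℰ` is the
composite of the isomorphisms `log ≅ 𝟭` and the identities `λ ⋙ (𝒩 → ℰ) = (𝒳 → ℰ)` met along the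
paths, i.e. "the Galois group is left undisturbed".  Also here: the first half of Cor. 3.6 (v)
REDUCED to its one model-dependent ingredient ("`□` is a nexus of `Γ⃗_𝒟`" is proved outright, so
`NexusRigidStmt ↔` total rigidity of `𝒟_{≤□}`, which is Prop. 3.2 (iv) for the MLF instance), and
the object equalities quantified in the pinned-homotopy clauses of (ii), (iii), (iv) PROVED (so
those `∀ e₁ e₂` quantifiers range over inhabited types: the clauses are not vacuous).  Nothing
here takes a side on inter-universal Teichmüller theory.
-/

namespace Literature.AnabelianGeometry.AbsoluteAnabelian

open _root_.CategoryTheory _root_.Quiver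

universe v u w

namespace DiagramOfCategories.OverData

variable {V : Type w} [Quiver.{v} V] {D : DiagramOfCategories.{v, u, w} V}
variable {C : Type u} [Category.{v} C] (O : D.OverData C)

/-- Restriction of structure functors to a full sub-quiver (`DiagramOfCategories.restrict`).
[folklore] -/
def restrict (P : Set V) : (D.restrict P).OverData C where
  N a := O.N a.1
  μ e := O.μ e

end DiagramOfCategories.OverData

namespace LogFrobeniusData

open DiagramOfCategories

variable (Δ : LogFrobeniusData.{u})

/-! ### Every functor of `𝒟` lies over `ℰ` -/

/-- The structure functor to `ℰ` at each vertex of `𝒟`: `(𝒳 → ℰ) ∘ id_⋎` on the first row,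
`𝒳 → ℰ` at `□`, `𝒩 → ℰ`, `𝟭` at `ℰ`, the projection `Anab → ℰ`, `𝟭` at the second `ℰ`.
[cite: MochizukiAbsTopIII2015, Corollary 3.6 (i) p.80] -/
def overEFunctor : (a : LFVertex) → (Δ.diagram.obj a ⥤ Δ.E)
  | .row1 _ => Δ.toNexus ⋙ Δ.XtoE
  | .nexus => Δ.XtoE
  | .third => Δ.NtoE
  | .fourth => 𝟭 Δ.E
  | .fifth => Δ.AtoE
  | .sixth => 𝟭 Δ.E

/-- **"The Galois group is undisturbed"**: every functor of the diagram `𝒟` of Cor. 3.6 lies over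
`ℰ` — `log` via `log ≅ 𝟭`, `id_⋎` strictly, `λ^×`/`λ^{×pf}` by `λ ⋙ (𝒩 → ℰ) = (𝒳 → ℰ)`, `κ_An` via
`κ_An ⋙ (Anab → ℰ) ≅ 𝟭` (proof of Cor. 3.6 (i), p. 80). [cite: MochizukiAbsTopIII2015, Corollary 3.6 (i) p.80] -/
def overE : Δ.diagram.OverData Δ.E where
  N := Δ.overEFunctor
  μ {a b} e := match a, b, e with
    | .row1 _, .row1 _, _ =>
      Functor.isoWhiskerRight Δ.logIsoId (Δ.toNexus ⋙ Δ.XtoE) ≪≫ (Δ.toNexus ⋙ Δ.XtoE).leftUnitor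
    | .row1 _, .nexus, _ => Iso.refl _
    | .nexus, .third, ⟨true⟩ => eqToIso Δ.lamTimes_NtoE
    | .nexus, .third, ⟨false⟩ => eqToIso Δ.lamPf_NtoE
    | .third, .fourth, _ => Δ.NtoE.rightUnitor
    | .fourth, .fifth, _ => Δ.κ_inv
    | .fifth, .sixth, _ => Δ.AtoE.rightUnitor
    | .row1 _, .third, e => PEmpty.elim e
    | .row1 _, .fourth, e => PEmpty.elim e
    | .row1 _, .fifth, e => PEmpty.elim e
    | .row1 _, .sixth, e => PEmpty.elim e
    | .nexus, .row1 _, e => PEmpty.elim e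
    | .nexus, .nexus, e => PEmpty.elim e
    | .nexus, .fourth, e => PEmpty.elim e
    | .nexus, .fifth, e => PEmpty.elim e
    | .nexus, .sixth, e => PEmpty.elim e
    | .third, .row1 _, e => PEmpty.elim e
    | .third, .nexus, e => PEmpty.elim e
    | .third, .third, e => PEmpty.elim e
    | .third, .fifth, e => PEmpty.elim e
    | .third, .sixth, e => PEmpty.elim e
    | .fourth, .row1 _, e => PEmpty.elim e
    | .fourth, .nexus, e => PEmpty.elim e
    | .fourth, .third, e => PEmpty.elim e
    | .fourth, .fourth, e => PEmpty.elim e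
    | .fourth, .sixth, e => PEmpty.elim e
    | .fifth, .row1 _, e => PEmpty.elim e
    | .fifth, .nexus, e => PEmpty.elim e
    | .fifth, .third, e => PEmpty.elim e
    | .fifth, .fourth, e => PEmpty.elim e
    | .fifth, .fifth, e => PEmpty.elim e
    | .sixth, .row1 _, e => PEmpty.elim e
    | .sixth, .nexus, e => PEmpty.elim e
    | .sixth, .third, e => PEmpty.elim e
    | .sixth, .fourth, e => PEmpty.elim e
    | .sixth, .fifth, e => PEmpty.elim e
    | .sixth, .sixth, e => PEmpty.elim e

/-! ### Corollary 3.6 (i), `n = 4`: `ℰ` is a core of `𝒟_{≤3}` -/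

/-- The observation functor `𝒩 → ℰ` of `𝒟_{≤4}` agrees with the structure functor at `𝒩`. [folklore] -/
def coreCompat4 : ∀ (a : SubVertex {a : LFVertex | a.row ≤ 3}) (i : coreShape4.{u}.I a),
    Δ.coreExt4.obsMap i ≅ (Δ.overE.restrict {a : LFVertex | a.row ≤ 3}).N a
  | ⟨.third, _⟩, _ => Iso.refl _
  | ⟨.row1 _, _⟩, i => PEmpty.elim i
  | ⟨.nexus, _⟩, i => PEmpty.elim i
  | ⟨.fourth, _⟩, i => PEmpty.elim i
  | ⟨.fifth, _⟩, i => PEmpty.elim i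
  | ⟨.sixth, _⟩, i => PEmpty.elim i

/-- Every vertex of `𝒟_{≤3}` reaches `ℰ` ("every vertex of `Γ⃗_𝒟` appears as the initial vertex of a path
… with terminal vertex equal to `v_𝒮`"). [cite: MochizukiAbsTopIII2015, Definition 3.5 (iii) p.75] -/
theorem reaches4 : ∀ a : SubVertex {a : LFVertex | a.row ≤ 3},
    Nonempty (Path (coreShape4.{u}.base a) coreShape4.{u}.obs)
  | ⟨.row1 n, h⟩ =>
    ⟨((((Path.nil : Path (coreShape4.{u}.base ⟨.row1 n, h⟩) (coreShape4.{u}.base ⟨.row1 n, h⟩)).cons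
      (show coreShape4.{u}.base ⟨.row1 n, h⟩ ⟶ coreShape4.{u}.base (vx 3 .nexus (by decide)) from
        LFVertex.idEdge n)).cons
      (show coreShape4.{u}.base (vx 3 .nexus (by decide)) ⟶ coreShape4.{u}.base (vx 3 .third (by decide))
        from LFVertex.lamTimesEdge)).cons
      (show coreShape4.{u}.base (vx 3 .third (by decide)) ⟶ coreShape4.{u}.obs from PUnit.unit))⟩
  | ⟨.nexus, h⟩ =>
    ⟨(((Path.nil : Path (coreShape4.{u}.base ⟨.nexus, h⟩) (coreShape4.{u}.base ⟨.nexus, h⟩)).cons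
      (show coreShape4.{u}.base ⟨.nexus, h⟩ ⟶ coreShape4.{u}.base (vx 3 .third (by decide))
        from LFVertex.lamTimesEdge)).cons
      (show coreShape4.{u}.base (vx 3 .third (by decide)) ⟶ coreShape4.{u}.obs from PUnit.unit))⟩
  | ⟨.third, h⟩ =>
    ⟨(Path.nil : Path (coreShape4.{u}.base ⟨.third, h⟩) (coreShape4.{u}.base ⟨.third, h⟩)).cons
      (show coreShape4.{u}.base ⟨.third, h⟩ ⟶ coreShape4.{u}.obs from PUnit.unit)⟩
  | ⟨.fourth, h⟩ => by simp [LFVertex.row] at h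
  | ⟨.fifth, h⟩ => by simp [LFVertex.row] at h
  | ⟨.sixth, h⟩ => by simp [LFVertex.row] at h

/-- The natural core structure `(𝒟_{≤4}, ℰ, ℋ)` on `𝒟_{≤3}` of Cor. 3.6 (i): homotopies = the isomorphisms of
Galois groups along the paths. [cite: MochizukiAbsTopIII2015, Corollary 3.6 (i) p.79] -/
noncomputable def coreFamily4 : Δ.core4Diagram.HomotopyFamily :=
  ((Δ.sub 3).coreObservable coreShape4 (fun _ => inferInstanceAs (IsEmpty PEmpty)) Δ.coreExt4
    (Δ.overE.restrict {a : LFVertex | a.row ≤ 3}) Δ.coreCompat4).H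

/-- **Cor. 3.6 (i), `n = 4`, PROVED** over the abstract data: `ℰ` forms a core of `𝒟_{≤3}`.
[cite: MochizukiAbsTopIII2015, Corollary 3.6 (i) p.79] -/
theorem coreStmt4 : Δ.CoreStmt4 :=
  ⟨Δ.coreFamily4, fun _ _ _ _ h => h,
    (Δ.sub 3).isCore_coreObservable coreShape4 (fun _ => inferInstanceAs (IsEmpty PEmpty)) Δ.coreExt4
      (Δ.overE.restrict {a : LFVertex | a.row ≤ 3}) Δ.coreCompat4 reaches4⟩

/-! ### Corollary 3.6 (i), `n = 5`: `Anab` is a core of `𝒟_{≤4}` -/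

/-- The observation functor `κ_An : ℰ → Anab` of `𝒟_{≤5}` agrees with the structure functor `𝟭 ⋙ κ_An`
at `ℰ` (structure functors over `Anab` = those over `ℰ` pushed along `κ_An`). [folklore] -/
def coreCompat5 : ∀ (a : SubVertex {a : LFVertex | a.row ≤ 4}) (i : coreShape5.{u}.I a),
    Δ.coreExt5.obsMap i ≅ ((Δ.overE.map Δ.κ).restrict {a : LFVertex | a.row ≤ 4}).N a
  | ⟨.fourth, _⟩, _ => Δ.κ.leftUnitor.symm
  | ⟨.row1 _, _⟩, i => PEmpty.elim i
  | ⟨.nexus, _⟩, i => PEmpty.elim i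
  | ⟨.third, _⟩, i => PEmpty.elim i
  | ⟨.fifth, _⟩, i => PEmpty.elim i
  | ⟨.sixth, _⟩, i => PEmpty.elim i

/-- Every vertex of `𝒟_{≤4}` reaches `Anab`. [cite: MochizukiAbsTopIII2015, Definition 3.5 (iii) p.75] -/
theorem reaches5 : ∀ a : SubVertex {a : LFVertex | a.row ≤ 4},
    Nonempty (Path (coreShape5.{u}.base a) coreShape5.{u}.obs)
  | ⟨.row1 n, h⟩ =>
    ⟨(((((Path.nil : Path (coreShape5.{u}.base ⟨.row1 n, h⟩) (coreShape5.{u}.base ⟨.row1 n, h⟩)).cons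
      (show coreShape5.{u}.base ⟨.row1 n, h⟩ ⟶ coreShape5.{u}.base (vx 4 .nexus (by decide)) from
        LFVertex.idEdge n)).cons
      (show coreShape5.{u}.base (vx 4 .nexus (by decide)) ⟶ coreShape5.{u}.base (vx 4 .third (by decide))
        from LFVertex.lamTimesEdge)).cons
      (show coreShape5.{u}.base (vx 4 .third (by decide)) ⟶ coreShape5.{u}.base (vx 4 .fourth (by decide))
        from LFVertex.edge34)).cons
      (show coreShape5.{u}.base (vx 4 .fourth (by decide)) ⟶ coreShape5.{u}.obs from PUnit.unit))⟩
  | ⟨.nexus, h⟩ =>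
    ⟨((((Path.nil : Path (coreShape5.{u}.base ⟨.nexus, h⟩) (coreShape5.{u}.base ⟨.nexus, h⟩)).cons
      (show coreShape5.{u}.base ⟨.nexus, h⟩ ⟶ coreShape5.{u}.base (vx 4 .third (by decide))
        from LFVertex.lamTimesEdge)).cons
      (show coreShape5.{u}.base (vx 4 .third (by decide)) ⟶ coreShape5.{u}.base (vx 4 .fourth (by decide))
        from LFVertex.edge34)).cons
      (show coreShape5.{u}.base (vx 4 .fourth (by decide)) ⟶ coreShape5.{u}.obs from PUnit.unit))⟩
  | ⟨.third, h⟩ =>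
    ⟨(((Path.nil : Path (coreShape5.{u}.base ⟨.third, h⟩) (coreShape5.{u}.base ⟨.third, h⟩)).cons
      (show coreShape5.{u}.base ⟨.third, h⟩ ⟶ coreShape5.{u}.base (vx 4 .fourth (by decide))
        from LFVertex.edge34)).cons
      (show coreShape5.{u}.base (vx 4 .fourth (by decide)) ⟶ coreShape5.{u}.obs from PUnit.unit))⟩
  | ⟨.fourth, h⟩ =>
    ⟨(Path.nil : Path (coreShape5.{u}.base ⟨.fourth, h⟩) (coreShape5.{u}.base ⟨.fourth, h⟩)).cons
      (show coreShape5.{u}.base ⟨.fourth, h⟩ ⟶ coreShape5.{u}.obs from PUnit.unit)⟩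
  | ⟨.fifth, h⟩ => by simp [LFVertex.row] at h
  | ⟨.sixth, h⟩ => by simp [LFVertex.row] at h

/-- The natural core structure `(𝒟_{≤5}, Anab, ℋ)` on `𝒟_{≤4}` of Cor. 3.6 (i).
[cite: MochizukiAbsTopIII2015, Corollary 3.6 (i) p.79] -/
noncomputable def coreFamily5 : Δ.core5Diagram.HomotopyFamily :=
  ((Δ.sub 4).coreObservable coreShape5 (fun _ => inferInstanceAs (IsEmpty PEmpty)) Δ.coreExt5
    ((Δ.overE.map Δ.κ).restrict {a : LFVertex | a.row ≤ 4}) Δ.coreCompat5).H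

/-- **Cor. 3.6 (i), `n = 5`, PROVED** over the abstract data: `Anab` forms a core of `𝒟_{≤4}`.
[cite: MochizukiAbsTopIII2015, Corollary 3.6 (i) p.79] -/
theorem coreStmt5 : Δ.CoreStmt5 :=
  ⟨Δ.coreFamily5, fun _ _ _ _ h => h,
    (Δ.sub 4).isCore_coreObservable coreShape5 (fun _ => inferInstanceAs (IsEmpty PEmpty)) Δ.coreExt5
      ((Δ.overE.map Δ.κ).restrict {a : LFVertex | a.row ≤ 4}) Δ.coreCompat5 reaches5⟩

/-! ### Corollary 3.6 (i), `n = 6`: the second `ℰ` is a core of `𝒟_{≤5}` -/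

/-- The observation functor `Anab → ℰ` of `𝒟_{≤6}` agrees with the structure functor at `Anab`. [folklore] -/
def coreCompat6 : ∀ (a : SubVertex {a : LFVertex | a.row ≤ 5}) (i : coreShape6.{u}.I a),
    Δ.coreExt6.obsMap i ≅ (Δ.overE.restrict {a : LFVertex | a.row ≤ 5}).N a
  | ⟨.fifth, _⟩, _ => Iso.refl _
  | ⟨.row1 _, _⟩, i => PEmpty.elim i
  | ⟨.nexus, _⟩, i => PEmpty.elim i
  | ⟨.third, _⟩, i => PEmpty.elim i
  | ⟨.fourth, _⟩, i => PEmpty.elim i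
  | ⟨.sixth, _⟩, i => PEmpty.elim i

/-- Every vertex of `𝒟_{≤5}` reaches the second `ℰ`. [cite: MochizukiAbsTopIII2015, Definition 3.5 (iii) p.75] -/
theorem reaches6 : ∀ a : SubVertex {a : LFVertex | a.row ≤ 5},
    Nonempty (Path (coreShape6.{u}.base a) coreShape6.{u}.obs)
  | ⟨.row1 n, h⟩ =>
    ⟨((((((Path.nil : Path (coreShape6.{u}.base ⟨.row1 n, h⟩) (coreShape6.{u}.base ⟨.row1 n, h⟩)).cons
      (show coreShape6.{u}.base ⟨.row1 n, h⟩ ⟶ coreShape6.{u}.base (vx 5 .nexus (by decide)) from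
        LFVertex.idEdge n)).cons
      (show coreShape6.{u}.base (vx 5 .nexus (by decide)) ⟶ coreShape6.{u}.base (vx 5 .third (by decide))
        from LFVertex.lamTimesEdge)).cons
      (show coreShape6.{u}.base (vx 5 .third (by decide)) ⟶ coreShape6.{u}.base (vx 5 .fourth (by decide))
        from LFVertex.edge34)).cons
      (show coreShape6.{u}.base (vx 5 .fourth (by decide)) ⟶ coreShape6.{u}.base (vx 5 .fifth (by decide))
        from LFVertex.edge45)).cons
      (show coreShape6.{u}.base (vx 5 .fifth (by decide)) ⟶ coreShape6.{u}.obs from PUnit.unit))⟩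
  | ⟨.nexus, h⟩ =>
    ⟨(((((Path.nil : Path (coreShape6.{u}.base ⟨.nexus, h⟩) (coreShape6.{u}.base ⟨.nexus, h⟩)).cons
      (show coreShape6.{u}.base ⟨.nexus, h⟩ ⟶ coreShape6.{u}.base (vx 5 .third (by decide))
        from LFVertex.lamTimesEdge)).cons
      (show coreShape6.{u}.base (vx 5 .third (by decide)) ⟶ coreShape6.{u}.base (vx 5 .fourth (by decide))
        from LFVertex.edge34)).cons
      (show coreShape6.{u}.base (vx 5 .fourth (by decide)) ⟶ coreShape6.{u}.base (vx 5 .fifth (by decide))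
        from LFVertex.edge45)).cons
      (show coreShape6.{u}.base (vx 5 .fifth (by decide)) ⟶ coreShape6.{u}.obs from PUnit.unit))⟩
  | ⟨.third, h⟩ =>
    ⟨((((Path.nil : Path (coreShape6.{u}.base ⟨.third, h⟩) (coreShape6.{u}.base ⟨.third, h⟩)).cons
      (show coreShape6.{u}.base ⟨.third, h⟩ ⟶ coreShape6.{u}.base (vx 5 .fourth (by decide))
        from LFVertex.edge34)).cons
      (show coreShape6.{u}.base (vx 5 .fourth (by decide)) ⟶ coreShape6.{u}.base (vx 5 .fifth (by decide))
        from LFVertex.edge45)).cons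
      (show coreShape6.{u}.base (vx 5 .fifth (by decide)) ⟶ coreShape6.{u}.obs from PUnit.unit))⟩
  | ⟨.fourth, h⟩ =>
    ⟨(((Path.nil : Path (coreShape6.{u}.base ⟨.fourth, h⟩) (coreShape6.{u}.base ⟨.fourth, h⟩)).cons
      (show coreShape6.{u}.base ⟨.fourth, h⟩ ⟶ coreShape6.{u}.base (vx 5 .fifth (by decide))
        from LFVertex.edge45)).cons
      (show coreShape6.{u}.base (vx 5 .fifth (by decide)) ⟶ coreShape6.{u}.obs from PUnit.unit))⟩
  | ⟨.fifth, h⟩ =>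
    ⟨(Path.nil : Path (coreShape6.{u}.base ⟨.fifth, h⟩) (coreShape6.{u}.base ⟨.fifth, h⟩)).cons
      (show coreShape6.{u}.base ⟨.fifth, h⟩ ⟶ coreShape6.{u}.obs from PUnit.unit)⟩
  | ⟨.sixth, h⟩ => by simp [LFVertex.row] at h

/-- The natural core structure `(𝒟_{≤6}, ℰ, ℋ)` on `𝒟_{≤5}` of Cor. 3.6 (i).
[cite: MochizukiAbsTopIII2015, Corollary 3.6 (i) p.79] -/
noncomputable def coreFamily6 : Δ.core6Diagram.HomotopyFamily :=
  ((Δ.sub 5).coreObservable coreShape6 (fun _ => inferInstanceAs (IsEmpty PEmpty)) Δ.coreExt6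
    (Δ.overE.restrict {a : LFVertex | a.row ≤ 5}) Δ.coreCompat6).H

/-- **Cor. 3.6 (i), `n = 6`, PROVED** over the abstract data: the second copy of `ℰ` forms a core of
`𝒟_{≤5}`. [cite: MochizukiAbsTopIII2015, Corollary 3.6 (i) p.79] -/
theorem coreStmt6 : Δ.CoreStmt6 :=
  ⟨Δ.coreFamily6, fun _ _ _ _ h => h,
    (Δ.sub 5).isCore_coreObservable coreShape6 (fun _ => inferInstanceAs (IsEmpty PEmpty)) Δ.coreExt6
      (Δ.overE.restrict {a : LFVertex | a.row ≤ 5}) Δ.coreCompat6 reaches6⟩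

/-! ### Corollary 3.6 (v), first half: `□` is a nexus; rigidity is the only model input -/

/-- **"The unique vertex `□` of the second row of `𝒟` is a nexus of `Γ⃗_𝒟`"** (Cor. 3.6 (v); §0 p. 27:
removing `□` disconnects the first row from rows 3–6, and every edge at `□` comes in from the first
row or goes out to `𝒩`) — PROVED for the quiver `LFVertex`.
[cite: MochizukiAbsTopIII2015, Corollary 3.6 (v) p.80] -/
theorem isNexus_nexus : IsNexus (V := LFVertex) .nexus {a : LFVertex | a.row = 1} where
  not_mem := by simp [LFVertex.row]
  pre_nonempty := ⟨.row1 0, by simp [LFVertex.row]⟩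
  post_nonempty := ⟨.third, by decide, by simp [LFVertex.row]⟩
  no_edge_across a b ha hb hbn := by
    simp only [Set.mem_setOf_eq] at ha hb
    cases a <;> cases b <;> simp [LFVertex.row] at ha hb hbn <;>
      exact ⟨⟨fun e => nomatch e⟩, ⟨fun e => nomatch e⟩⟩
  edge_in a h := by
    cases a with
    | row1 n => simp [LFVertex.row]
    | _ => exact (nomatch h.some)
  edge_out b h := by
    cases b with
    | third => exact ⟨by simp [LFVertex.row], by decide⟩
    | _ => exact (nomatch h.some)

/-- **Cor. 3.6 (v), first half, reduced**: given that `□` IS a nexus (`isNexus_nexus`), the typed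
statement `NexusRigidStmt` ("`□` is a nexus and `𝒟` is totally `□`-rigid") is EQUIVALENT to the total
rigidity of the pre-nexus portion `𝒟_{≤□}` (the copies of `𝒳` with `log`, `id_⋎`), which for the MLF
instance is Prop. 3.2 (iv) (id-rigidity of `𝒞^{MLF-sB}_T`) — the only model-dependent input.
[cite: MochizukiAbsTopIII2015, Corollary 3.6 (v) p.82] -/
theorem nexusRigidStmt_iff :
    Δ.NexusRigidStmt ↔
      (Δ.diagram.restrict ({a : LFVertex | a.row = 1} ∪ {LFVertex.nexus})).IsTotallyRigid :=
  ⟨fun h => h.2, fun h => ⟨isNexus_nexus, h⟩⟩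

/-! ### Non-vacuity of the pinned-homotopy clauses of (ii), (iii), (iv) -/

section NonVacuity

variable (J : SubVertex {a : LFVertex | a.row ≤ 4} → Type u)
  (telMap : ∀ {a}, J a → (Δ.A ⥤ (Δ.sub 4).obj a))

/-- Object equality `e₁` of the `η_{□⋎}` clause of `TelecoreStmt`: `[φ_□]` acts on objects by `φ_□`
(so, under `IsTelecoreAn`, by `φ_An`). [cite: MochizukiAbsTopIII2015, Corollary 3.6 (ii) p.79] -/
theorem pathPhiNexus_obj (j : J (vx 4 .nexus (by decide))) (a : Δ.A) :
    ((Δ.teleDiagram J telMap).pathFunctor (pathPhiNexus j)).obj a = (telMap j).obj a := by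
  simp only [pathPhiNexus, pathFunctor_cons, pathFunctor_nil]; rfl

/-- Object equality `e₂` of the `η_{□⋎}` clause: `[id_⋎] ∘ [φ_⋎]` acts by `id_⋎ ∘ φ_⋎`.
[cite: MochizukiAbsTopIII2015, Corollary 3.6 (ii) p.80] -/
theorem pathPhiId_obj (n : ℤ) (jn : J (vx 4 (.row1 n) (by simp [LFVertex.row]))) (a : Δ.A) :
    ((Δ.teleDiagram J telMap).pathFunctor (pathPhiId n jn)).obj a =
      Δ.toNexus.obj ((telMap jn).obj a) := by
  simp only [pathPhiId, pathFunctor_cons, pathFunctor_nil]; rfl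

/-- Object equality `e₁` of the `η_□` clause: `[β¹_□]` acts by `φ_□ ∘ κ_An ∘ (𝒩 → ℰ) ∘ λ^×`, and
`(𝒩 → ℰ) ∘ λ^× = (𝒳 → ℰ)` on objects. [cite: MochizukiAbsTopIII2015, Corollary 3.6 (ii) p.79] -/
theorem pathBetaNexus_obj (j : J (vx 4 .nexus (by decide))) (x : Δ.X) :
    ((Δ.teleDiagram J telMap).pathFunctor (pathBetaNexus j)).obj x =
      (telMap j).obj (Δ.κ.obj (Δ.XtoE.obj x)) := by
  simp only [pathBetaNexus, pathFunctor_cons, pathFunctor_nil]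
  change (telMap j).obj (Δ.κ.obj (Δ.NtoE.obj (Δ.lamTimes.obj x))) = _
  rw [← Functor.comp_obj Δ.lamTimes Δ.NtoE, Δ.lamTimes_NtoE]

/-- Object equality `e₁` of the `η_⋎` clause: `[β¹_⋎]` acts by `φ_⋎ ∘ κ_An ∘ (𝒳 → ℰ) ∘ id_⋎`.
[cite: MochizukiAbsTopIII2015, Corollary 3.6 (ii) p.79] -/
theorem pathBetaRow1_obj (n : ℤ) (jn : J (vx 4 (.row1 n) (by simp [LFVertex.row]))) (x : Δ.X₁) :
    ((Δ.teleDiagram J telMap).pathFunctor (pathBetaRow1 n jn)).obj x =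
      (telMap jn).obj (Δ.κ.obj (Δ.XtoE.obj (Δ.toNexus.obj x))) := by
  simp only [pathBetaRow1, pathFunctor_cons, pathFunctor_nil]
  change (telMap jn).obj (Δ.κ.obj (Δ.NtoE.obj (Δ.lamTimes.obj (Δ.toNexus.obj x)))) = _
  rw [← Functor.comp_obj Δ.lamTimes Δ.NtoE, Δ.lamTimes_NtoE]

/-- Object equality `e₂` of the `η_⋏` clauses: the length-zero path `β⁰_⋏` acts by the identity.
[cite: MochizukiAbsTopIII2015, Corollary 3.6 (ii) p.79] -/
theorem pathNil_obj {a : (teleShape J).Vertex} (x : (Δ.teleDiagram J telMap).obj a) :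
    ((Δ.teleDiagram J telMap).pathFunctor (Path.nil : Path a a)).obj x = x := by
  simp only [pathFunctor_nil, Functor.id_obj]

/-- Object equalities of the type-(1) clause of `LogPinned` (in `𝒟_{≤3}`): the two paths act by
`λ^× ∘ id_⋎ ∘ log` and `λ^{×pf} ∘ id_{⋎+1}`. [cite: MochizukiAbsTopIII2015, Corollary 3.6 (iii) p.81] -/
theorem logPair_obj (n : ℤ) (x : Δ.X₁) :
    (Δ.sub3.pathFunctor (logPairLeft n)).obj x = Δ.lamTimes.obj (Δ.toNexus.obj (Δ.log.obj x)) ∧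
      (Δ.sub3.pathFunctor (logPairRight n)).obj x = Δ.lamPf.obj (Δ.toNexus.obj x) := by
  constructor <;> simp only [logPairLeft, logPairRight, pathFunctor_cons, pathFunctor_nil] <;> rfl

/-- Object equalities of the type-(2) clause of `LogPinned`: `[λ^×]`, `[λ^{×pf}]` act by `λ^×`, `λ^{×pf}`.
[cite: MochizukiAbsTopIII2015, Corollary 3.6 (iii) p.81] -/
theorem timesPair_obj (x : Δ.X) :
    (Δ.sub3.pathFunctor ((Path.nil : Path lvNexus.{u} lvNexus).cons eLamTimes)).obj x = Δ.lamTimes.obj x ∧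
      (Δ.sub3.pathFunctor ((Path.nil : Path lvNexus.{u} lvNexus).cons eLamPf)).obj x = Δ.lamPf.obj x := by
  constructor <;> simp only [pathFunctor_cons, pathFunctor_nil] <;> rfl

/-- Object equalities of the type-(1) clause of `TeleLogPinned` (in a telecore diagram).
[cite: MochizukiAbsTopIII2015, Corollary 3.6 (iv) p.82] -/
theorem tLogPair_obj (n : ℤ) (x : Δ.X₁) :
    ((Δ.teleDiagram J telMap).pathFunctor (tLogPairLeft J n)).obj x =
        Δ.lamTimes.obj (Δ.toNexus.obj (Δ.log.obj x)) ∧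
      ((Δ.teleDiagram J telMap).pathFunctor (tLogPairRight J n)).obj x = Δ.lamPf.obj (Δ.toNexus.obj x) := by
  constructor <;> simp only [tLogPairLeft, tLogPairRight, pathFunctor_cons, pathFunctor_nil] <;> rfl

/-- Object equalities of the type-(2) clause of `TeleLogPinned`.
[cite: MochizukiAbsTopIII2015, Corollary 3.6 (iv) p.82] -/
theorem tTimesPair_obj (x : Δ.X) :
    ((Δ.teleDiagram J telMap).pathFunctor (tTimesPath J)).obj x = Δ.lamTimes.obj x ∧
      ((Δ.teleDiagram J telMap).pathFunctor (tPfPath J)).obj x = Δ.lamPf.obj x := by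
  constructor <;> simp only [tTimesPath, tPfPath, pathFunctor_cons, pathFunctor_nil] <;> rfl

end NonVacuity

end LogFrobeniusData

end Literature.AnabelianGeometry.AbsoluteAnabelian
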